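import Literature.Analysis.ValidatedNumerics.TaylorModelIntegralCert3DAdaptive
import Literature.Analysis.ValidatedNumerics.TaylorModelMultivariateTrig
import HarnessLib

/-!
# Triple-integral certificates with trigonometric nodes: boxes, box splits, kd-trees and graph-shaped domains

Trunk T-ANA (Analysis/ValidatedNumerics); namespace `Literature.Analysis.ValidatedNumerics.PolyMP`.
Sequel of `TaylorModelIntegralCert3D.lean` (the grid certificate generic in a box modeller `Φ`: `certCheck3G`,
`boxCheckG3` / `sumCheckG3`, and the expression language `BExpr3` without trigonometric nodes),
`TaylorModelIntegralCert3DAdaptive.lean` (kd-tree certificates generic in a modeller `Ψ`: `leafCheckG3` / `treeCheckG3` /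
`integral_bounds_of_leafCheckG3`, the heuristic `kdRefine3`), `TaylorModelMultivariateTrig.lean` (`tsin3TM` / `tcos3TM`)
and the 3-D analogue of `TaylorModelIntegralCert2DTrig.lean`.  The generic layers are instantiated once more, for the
richer code list, and the domain is freed from the box shape by two nested substitutions:

* **Part A — the expression language `BExpr3T`**: `const`, `varX`, `varY`, `varZ`, `neg`, `add`, `sub`, `mul`, `exp`,
  `log`, `inv`, `sqrt`, `sin`, `cos` with `toFun₃`, joint measurability, the box model `BExpr3T.model S h k l P cx cy cz`
  and `tmem3_model` (`sin` / `cos` take their series order from `P.K` and the point-value budget `cisPt S P.Ke P.ke`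
  from the exponential's fields of `EPrm`, so that kd-tree leaves keep ONE parameter record);
* **Part B — certificates over a box**: one-shot `certCheck3T` / `integral_bounds_of_certCheck3T` and box-split
  `boxCheck3T` / `sumCheck3T` / `integral_bounds_of_boxCheck3T`;
* **Part C — adaptive certificates**: `leafCheck3T` / `treeCheck3T` / `integral_bounds_of_leafCheck3T` and the
  refinement heuristic `kdRefine3T`;
* **Part D — graph-shaped limits** `∫_{x} ∫_{y=A(x)}^{B(x)} ∫_{z=C(x,y)}^{D(x,y)} E dz dy dx` (`A`, `B` in `x` alone,
  `C`, `D` free of `z`: simplices, Feynman-parameter domains, regions between two surfaces) by the substitutions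
  `z = C + t (D − C)` then `y = A + s (B − A)`, `s, t ∈ [0, 1]` (`BExpr3T.substY`, `substZ`, `inner3`, `graphIntegrand3`;
  Mathlib `intervalIntegral.smul_integral_comp_mul_add` twice): `integral_graphIntegrand3_eq`, the box-split form
  `integral_bounds_of_boxCheck3GraphT` on `[ax, ax + 2nh] × [0, 1]²` and the ADAPTIVE form
  `integral_bounds_of_leafCheck3GraphT` (a kd-tree over `[x0, x1] × [0, 1]²`).

All conclusions are hypothesis-free real inequalities once the Boolean obligations hold (`decide`, one per box / leaf).
Deliberately NOT here: `tan`, `arctan`, singular integrands, dimension `≥ 4`.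
Problem-independent; no facts, no axioms; all certificate data computable over `ℤ`.

## References

* K. Makino, M. Berz, *Taylor models and other validated functional inclusion methods*, Int. J. Pure Appl. Math. 4
  (2003) 379–456: Algorithm 2 (quadrature with Taylor models: identity models, code list in Taylor-model arithmetic,
  exact integration of the polynomial part over a partition of the domain box), Definition 3 (intrinsics incl.
  `sin`, `cos`). [cite: MakinoBerz2003, Algorithm 2] [cite: MakinoBerz2003, Definition 3]
* M. Berz, K. Makino, *New methods for high-dimensional verified quadrature*, Reliable Computing 5 (1999) 13–22,
  Sect. 2 (few large boxes suffice in dimension `d ≥ 3`). [cite: BerzMakino1999, Sect. 2]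
* A. Mahboubi, G. Melquiond, T. Sibut-Pinote, *Formally verified approximations of definite integrals*, ITP 2016,
  LNCS 9807, 274–289: Sect. 3.2 Lemma 3 (polynomial enclosure of the integral), Sect. 3.3 (adaptive splitting of the
  domain, enclosures of the pieces added and checked by computation). [cite: MahboubiMelquiondSibutpinote2016, Sect. 3.3]
* M. Joldeş, *Rigorous Polynomial Approximations and Applications*, PhD thesis, ENS Lyon (2011), Algorithm 2.2.8
  (`TMComp` for `sin`, `cos`). [cite: Joldes2011, Algorithm 2.2.8]
* P. J. Davis, P. Rabinowitz, *Methods of Numerical Integration*, 2nd ed., Academic Press (1984), Sect. 5.6.1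
  (generalized product rules: the iterated integral with variable limits
  `∫ dx₁ ∫_{L₁(x₁)}^{U₁(x₁)} dx₂ ∫_{L₂(x₁,x₂)}^{U₂(x₁,x₂)} f dx₃`, (5.6.1.1), as a transformed integral over the cube).
  [cite: DavisRabinowitz1984, Sect. 5.6.1]
* The affine change of variables in an interval integral (Mathlib `intervalIntegral.smul_integral_comp_mul_add`).
  [folklore]
-/

open MeasureTheory intervalIntegral Set
open scoped Interval

namespace Literature.Analysis.ValidatedNumerics

namespace PolyMP

open Literature.Analysis.ValidatedNumerics.NumericsMP
open Literature.Analysis.ValidatedNumerics.ExpPoly (Poly)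
open Literature.Analysis.ValidatedNumerics.ExpPoly

/-! ### Part A. The expression language in three variables with trigonometric nodes -/

/-- Integrand expressions in `x`, `y`, `z`: rational constants, the variables, `−`, `+`, binary `−`, `·`, `exp`, `log`,
reciprocal, square root, `sin`, `cos` (the code list of op. cit. Algorithm 2 over the intrinsics of Definition 3).
[cite: MakinoBerz2003, Algorithm 2] -/
inductive BExpr3T : Type
  /-- the rational constant `q` -/
  | const (q : ℚ) : BExpr3T
  /-- the first variable `x` -/
  | varX : BExpr3T
  /-- the second variable `y` -/
  | varY : BExpr3T
  /-- the third variable `z` -/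
  | varZ : BExpr3T
  /-- `−A` -/
  | neg (A : BExpr3T) : BExpr3T
  /-- `A + B` -/
  | add (A B : BExpr3T) : BExpr3T
  /-- `A − B` -/
  | sub (A B : BExpr3T) : BExpr3T
  /-- `A · B` -/
  | mul (A B : BExpr3T) : BExpr3T
  /-- `exp A` -/
  | exp (A : BExpr3T) : BExpr3T
  /-- `log A` -/
  | log (A : BExpr3T) : BExpr3T
  /-- `A⁻¹` -/
  | inv (A : BExpr3T) : BExpr3T
  /-- `√A` -/
  | sqrt (A : BExpr3T) : BExpr3T
  /-- `sin A` -/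
  | sin (A : BExpr3T) : BExpr3T
  /-- `cos A` -/
  | cos (A : BExpr3T) : BExpr3T

namespace BExpr3T

/-- The real function of three variables denoted by an expression (`log`, `⁻¹`, `√` are Mathlib's total functions).
[cite: MakinoBerz2003, Algorithm 2] -/
noncomputable def toFun₃ : BExpr3T → ℝ → ℝ → ℝ → ℝ
  | const q => fun _ _ _ => q
  | varX => fun x _ _ => x
  | varY => fun _ y _ => y
  | varZ => fun _ _ z => z
  | neg A => fun x y z => -toFun₃ A x y z
  | add A B => fun x y z => toFun₃ A x y z + toFun₃ B x y z
  | sub A B => fun x y z => toFun₃ A x y z - toFun₃ B x y z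
  | mul A B => fun x y z => toFun₃ A x y z * toFun₃ B x y z
  | exp A => fun x y z => Real.exp (toFun₃ A x y z)
  | log A => fun x y z => Real.log (toFun₃ A x y z)
  | inv A => fun x y z => (toFun₃ A x y z)⁻¹
  | sqrt A => fun x y z => Real.sqrt (toFun₃ A x y z)
  | sin A => fun x y z => Real.sin (toFun₃ A x y z)
  | cos A => fun x y z => Real.cos (toFun₃ A x y z)

/-- Joint (Borel) measurability of the denoted function. [cite: MakinoBerz2003, Algorithm 2] -/
theorem measurable_toFun₃ : ∀ E : BExpr3T, Measurable fun z : ℝ × ℝ × ℝ => E.toFun₃ z.1 z.2.1 z.2.2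
  | const _ => measurable_const
  | varX => measurable_fst
  | varY => measurable_snd.fst
  | varZ => measurable_snd.snd
  | neg A => (measurable_toFun₃ A).neg
  | add A B => (measurable_toFun₃ A).add (measurable_toFun₃ B)
  | sub A B => (measurable_toFun₃ A).sub (measurable_toFun₃ B)
  | mul A B => (measurable_toFun₃ A).mul (measurable_toFun₃ B)
  | exp A => Real.measurable_exp.comp (measurable_toFun₃ A)
  | log A => Real.measurable_log.comp (measurable_toFun₃ A)
  | inv A => (measurable_toFun₃ A).inv
  | sqrt A => Real.continuous_sqrt.measurable.comp (measurable_toFun₃ A)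
  | sin A => Real.measurable_sin.comp (measurable_toFun₃ A)
  | cos A => Real.measurable_cos.comp (measurable_toFun₃ A)

/-- **The box Taylor model of `(u, v, w) ↦ E(cx + u, cy + v, cz + w)` on `|u| ≤ h, |v| ≤ k, |w| ≤ l`** with its
acceptance flag: the identity models, then the code list in trivariate Taylor-model arithmetic; `sin` / `cos` by
`tsin3TM` / `tcos3TM` with series order `P.K` and point values `cisPt S P.Ke P.ke`. [cite: MakinoBerz2003, Algorithm 2] -/
def model (S : ℕ) (h k l : ℚ) (P : EPrm) (cx cy cz : ℚ) : BExpr3T → IPoly3 × Bool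
  | const q => (tconst3 (ofRat S q), true)
  | varX => (tvarX3 S (ofRat S cx), true)
  | varY => (tvarY3 S (ofRat S cy), true)
  | varZ => (tvarZ3 S (ofRat S cz), true)
  | neg A =>
      let r := model S h k l P cx cy cz A
      (tneg3 r.1, r.2)
  | add A B =>
      let r := model S h k l P cx cy cz A
      let r' := model S h k l P cx cy cz B
      (tadd3 r.1 r'.1, r.2 && r'.2)
  | sub A B =>
      let r := model S h k l P cx cy cz A
      let r' := model S h k l P cx cy cz B
      (tsub3 r.1 r'.1, r.2 && r'.2)
  | mul A B =>
      let r := model S h k l P cx cy cz A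
      let r' := model S h k l P cx cy cz B
      (tmul3 S h k l P.D r.1 r'.1, r.2 && r'.2)
  | exp A =>
      let r := model S h k l P cx cy cz A
      let t := texp3TM S h k l P.D P.K P.Ke P.ke r.1
      (t.1, r.2 && t.2)
  | log A =>
      let r := model S h k l P cx cy cz A
      let t := tlog3TM S h k l P.D P.K P.Kl r.1
      (t.1, r.2 && t.2)
  | inv A =>
      let r := model S h k l P cx cy cz A
      let t := tinv3TM S h k l P.D P.K r.1
      (t.1, r.2 && t.2)
  | sqrt A =>
      let r := model S h k l P cx cy cz A
      let t := tsqrt3TM S h k l P.D P.K P.fuel r.1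
      (t.1, r.2 && t.2)
  | sin A =>
      let r := model S h k l P cx cy cz A
      let t := tsin3TM S h k l P.D P.K P.Ke P.ke r.1
      (t.1, r.2 && t.2)
  | cos A =>
      let r := model S h k l P cx cy cz A
      let t := tcos3TM S h k l P.D P.K P.Ke P.ke r.1
      (t.1, r.2 && t.2)

/-- **Soundness of `model`**: an accepted box model encloses `(u, v, w) ↦ E(cx + u, cy + v, cz + w)` on the box.
[cite: MakinoBerz2003, Algorithm 2] -/
theorem tmem3_model {S : ℕ} (hS : 0 < S) {h k l : ℚ} (h0 : 0 ≤ h) (k0 : 0 ≤ k) (l0 : 0 ≤ l) (P : EPrm)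
    (cx cy cz : ℚ) : ∀ E : BExpr3T, (model S h k l P cx cy cz E).2 = true →
      TMem3 S h k l (fun u v w => E.toFun₃ ((cx : ℝ) + u) ((cy : ℝ) + v) ((cz : ℝ) + w))
        (model S h k l P cx cy cz E).1
  | const q, _ => by
      simpa [model, toFun₃] using tmem3_const (h := h) (k := k) (l := l) (mem_ofRat S q)
  | varX, _ => by
      simpa [model, toFun₃] using tmem3_varX (S := S) (h := h) (k := k) (l := l) (mem_ofRat S cx)
  | varY, _ => by
      simpa [model, toFun₃] using tmem3_varY (S := S) (h := h) (k := k) (l := l) (mem_ofRat S cy)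
  | varZ, _ => by
      simpa [model, toFun₃] using tmem3_varZ (S := S) (h := h) (k := k) (l := l) (mem_ofRat S cz)
  | neg A, hok => by
      simp only [model] at hok ⊢
      exact tmem3_neg (tmem3_model hS h0 k0 l0 P cx cy cz A hok)
  | add A B, hok => by
      simp only [model, Bool.and_eq_true] at hok ⊢
      exact tmem3_add (tmem3_model hS h0 k0 l0 P cx cy cz A hok.1) (tmem3_model hS h0 k0 l0 P cx cy cz B hok.2)
  | sub A B, hok => by
      simp only [model, Bool.and_eq_true] at hok ⊢
      exact tmem3_sub (tmem3_model hS h0 k0 l0 P cx cy cz A hok.1) (tmem3_model hS h0 k0 l0 P cx cy cz B hok.2)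
  | mul A B, hok => by
      simp only [model, Bool.and_eq_true] at hok ⊢
      exact tmem3_mul hS h0 k0 l0 P.D (tmem3_model hS h0 k0 l0 P cx cy cz A hok.1)
        (tmem3_model hS h0 k0 l0 P cx cy cz B hok.2)
  | exp A, hok => by
      simp only [model, Bool.and_eq_true] at hok ⊢
      exact tmem3_exp_of_texp3TM hS h0 k0 l0 (tmem3_model hS h0 k0 l0 P cx cy cz A hok.1) hok.2
  | log A, hok => by
      simp only [model, Bool.and_eq_true] at hok ⊢
      exact tmem3_log_of_tlog3TM hS h0 k0 l0 (tmem3_model hS h0 k0 l0 P cx cy cz A hok.1) hok.2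
  | inv A, hok => by
      simp only [model, Bool.and_eq_true] at hok ⊢
      exact tmem3_inv_of_tinv3TM hS h0 k0 l0 (tmem3_model hS h0 k0 l0 P cx cy cz A hok.1) hok.2
  | sqrt A, hok => by
      simp only [model, Bool.and_eq_true] at hok ⊢
      exact tmem3_sqrt_of_tsqrt3TM hS h0 k0 l0 (tmem3_model hS h0 k0 l0 P cx cy cz A hok.1) hok.2
  | sin A, hok => by
      simp only [model, Bool.and_eq_true] at hok ⊢
      exact tmem3_sin_of_tsin3TM hS h0 k0 l0 (tmem3_model hS h0 k0 l0 P cx cy cz A hok.1) hok.2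
  | cos A, hok => by
      simp only [model, Bool.and_eq_true] at hok ⊢
      exact tmem3_cos_of_tcos3TM hS h0 k0 l0 (tmem3_model hS h0 k0 l0 P cx cy cz A hok.1) hok.2

/-- The box modeller of an expression in the shape the kd-tree layer expects. [cite: MakinoBerz2003, Algorithm 2] -/
def psi (S : ℕ) (E : BExpr3T) : ℚ → ℚ → ℚ → ℚ → ℚ → ℚ → EPrm → IPoly3 × Bool :=
  fun h k l cx cy cz P => model S h k l P cx cy cz E

end BExpr3T

/-! ### Part B. Certificates over a box (one-shot and box-split) -/

/-- **The one-shot certificate for `BExpr3T` integrands over a box** (`= certCheck3G` on `BExpr3T.model`).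
[cite: MakinoBerz2003, Algorithm 2] -/
def certCheck3T (S : ℕ) (h k l : ℚ) (P : EPrm) (E : BExpr3T) (ax ay az : ℚ) (n m o : ℕ) (lo hi : ℚ) : Bool :=
  certCheck3G S h k l (fun cx cy cz => BExpr3T.model S h k l P cx cy cz E) ax ay az n m o lo hi

/-- **Soundness** (no side hypotheses):
`certCheck3T … = true → lo ≤ ∫_{ax}^{ax+2nh} ∫_{ay}^{ay+2mk} ∫_{az}^{az+2ol} E ≤ hi`. [cite: MakinoBerz2003, Algorithm 2]
[cite: BerzMakino1999, Sect. 2] [cite: MahboubiMelquiondSibutpinote2016, Sect. 3.3] -/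
theorem integral_bounds_of_certCheck3T {S : ℕ} {h k l : ℚ} {P : EPrm} {E : BExpr3T} {ax ay az : ℚ}
    {n m o : ℕ} {lo hi : ℚ} (hc : certCheck3T S h k l P E ax ay az n m o lo hi = true) :
    (lo : ℝ) ≤ ∫ x in (ax : ℝ)..((ax : ℝ) + 2 * n * h), ∫ y in (ay : ℝ)..((ay : ℝ) + 2 * m * k),
        ∫ z in (az : ℝ)..((az : ℝ) + 2 * o * l), E.toFun₃ x y z ∧
      ∫ x in (ax : ℝ)..((ax : ℝ) + 2 * n * h), ∫ y in (ay : ℝ)..((ay : ℝ) + 2 * m * k),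
        ∫ z in (az : ℝ)..((az : ℝ) + 2 * o * l), E.toFun₃ x y z ≤ (hi : ℝ) := by
  have hpos : 0 < S ∧ 0 < h ∧ 0 < k ∧ 0 < l := by
    unfold certCheck3T certCheck3G at hc
    simp only [Bool.and_eq_true, decide_eq_true_eq] at hc
    exact ⟨hc.1.1.1.1.1.1, hc.1.1.1.1.1.2, hc.1.1.1.1.2, hc.1.1.1.2⟩
  exact integral_bounds_of_certCheck3G (BExpr3T.measurable_toFun₃ E)
    (fun cx cy cz hok => BExpr3T.tmem3_model hpos.1 hpos.2.1.le hpos.2.2.1.le hpos.2.2.2.le P cx cy cz E hok) hc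

/-- **Box-split certificate for `BExpr3T` integrands, kernel obligation for box `(i, j, p)`.**
[cite: MakinoBerz2003, Algorithm 2] -/
def boxCheck3T (S : ℕ) (h k l : ℚ) (P : EPrm) (E : BExpr3T) (ax ay az : ℚ) (Jsss : List (List (List MI)))
    (i j p : ℕ) : Bool :=
  boxCheckG3 S h k l (fun cx cy cz => BExpr3T.model S h k l P cx cy cz E) ax ay az Jsss i j p

/-- **Box-split certificate for `BExpr3T` integrands, final obligation.** [cite: MakinoBerz2003, Algorithm 2] -/
def sumCheck3T (S : ℕ) (h k l : ℚ) (P : EPrm) (E : BExpr3T) (ax ay az : ℚ) (Jsss : List (List (List MI)))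
    (n m o : ℕ) (lo hi : ℚ) : Bool :=
  sumCheckG3 S h k l (fun cx cy cz => BExpr3T.model S h k l P cx cy cz E) ax ay az Jsss n m o lo hi

/-- **Soundness of the box-split certificate** (no side hypotheses). [cite: MakinoBerz2003, Algorithm 2]
[cite: MahboubiMelquiondSibutpinote2016, Sect. 3.3] -/
theorem integral_bounds_of_boxCheck3T {S : ℕ} {h k l : ℚ} {P : EPrm} {E : BExpr3T} {ax ay az : ℚ}
    {Jsss : List (List (List MI))} {n m o : ℕ} {lo hi : ℚ}
    (hbox : ∀ i j p : ℕ, i < n → j < m → p < o → boxCheck3T S h k l P E ax ay az Jsss i j p = true)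
    (hsum : sumCheck3T S h k l P E ax ay az Jsss n m o lo hi = true) :
    (lo : ℝ) ≤ ∫ x in (ax : ℝ)..((ax : ℝ) + 2 * n * h), ∫ y in (ay : ℝ)..((ay : ℝ) + 2 * m * k),
        ∫ z in (az : ℝ)..((az : ℝ) + 2 * o * l), E.toFun₃ x y z ∧
      ∫ x in (ax : ℝ)..((ax : ℝ) + 2 * n * h), ∫ y in (ay : ℝ)..((ay : ℝ) + 2 * m * k),
        ∫ z in (az : ℝ)..((az : ℝ) + 2 * o * l), E.toFun₃ x y z ≤ (hi : ℝ) := by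
  have hpos : 0 < S ∧ 0 < h ∧ 0 < k ∧ 0 < l := by
    unfold sumCheck3T sumCheckG3 at hsum
    simp only [Bool.and_eq_true, decide_eq_true_eq] at hsum
    exact ⟨hsum.1.1.1.1.1, hsum.1.1.1.1.2, hsum.1.1.1.2, hsum.1.1.2⟩
  exact integral_bounds_of_boxCheckG3 (BExpr3T.measurable_toFun₃ E)
    (fun cx cy cz hok => BExpr3T.tmem3_model hpos.1 hpos.2.1.le hpos.2.2.1.le hpos.2.2.2.le P cx cy cz E hok)
    hbox hsum

/-! ### Part C. Adaptive (kd-tree) certificates -/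

/-- Kernel obligation for leaf `i`, `BExpr3T` integrand (one `decide` per leaf; vacuous past the last leaf).
[cite: MahboubiMelquiondSibutpinote2016, Sect. 3.3] -/
def leafCheck3T (S : ℕ) (E : BExpr3T) (t : KdTree3) (B : Box3Q) (i : ℕ) : Bool :=
  leafCheckG3 S (BExpr3T.psi S E) t B i

/-- Final obligation (`= treeCheckG3`: positivity of `S`, leaf count, `Σ claims ⊆ [lo·S, hi·S]`).
[cite: MahboubiMelquiondSibutpinote2016, Sect. 3.3] -/
def treeCheck3T (S : ℕ) (t : KdTree3) (n : ℕ) (lo hi : ℚ) : Bool := treeCheckG3 S t n lo hi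

/-- **Soundness of the adaptive certificate for `BExpr3T` integrands** (no side hypotheses).
[cite: MakinoBerz2003, Algorithm 2] [cite: MahboubiMelquiondSibutpinote2016, Sect. 3.3] -/
theorem integral_bounds_of_leafCheck3T {S : ℕ} {E : BExpr3T} {t : KdTree3} {B : Box3Q} {n : ℕ} {lo hi : ℚ}
    (hleaf : ∀ i : ℕ, i < n → leafCheck3T S E t B i = true) (ht : treeCheck3T S t n lo hi = true) :
    (lo : ℝ) ≤ ∫ x in (B.x0 : ℝ)..B.x1, ∫ y in (B.y0 : ℝ)..B.y1, ∫ z in (B.z0 : ℝ)..B.z1, E.toFun₃ x y z ∧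
      ∫ x in (B.x0 : ℝ)..B.x1, ∫ y in (B.y0 : ℝ)..B.y1, ∫ z in (B.z0 : ℝ)..B.z1, E.toFun₃ x y z ≤ (hi : ℝ) :=
  integral_bounds_of_leafCheckG3 (BExpr3T.measurable_toFun₃ E)
    (fun _ _ _ cx cy cz P hS h0 k0 l0 hok => BExpr3T.tmem3_model hS h0 k0 l0 P cx cy cz E hok) hleaf ht

/-- **Refinement heuristic** (bisection of the longest side while rejected or wider than `tol`, at most `depth` deep;
a PROPOSAL certified leaf by leaf). [cite: MahboubiMelquiondSibutpinote2016, Sect. 3.3] -/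
def kdRefine3T (S : ℕ) (E : BExpr3T) (P : EPrm) (tol : ℤ) : ℕ → Box3Q → KdTree3
  | 0, B => KdTree3.leaf P (leafEncl3 S (BExpr3T.psi S E) B P).1
  | d + 1, B =>
      let e := leafEncl3 S (BExpr3T.psi S E) B P
      if e.2 && decide (e.1.hi - e.1.lo ≤ tol) then KdTree3.leaf P e.1
      else
        let wx := B.x1 - B.x0
        let wy := B.y1 - B.y0
        let wz := B.z1 - B.z0
        if wy ≤ wx ∧ wz ≤ wx then
          let c := (B.x0 + B.x1) / 2
          KdTree3.splitX c (kdRefine3T S E P tol d ⟨B.x0, c, B.y0, B.y1, B.z0, B.z1⟩)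
            (kdRefine3T S E P tol d ⟨c, B.x1, B.y0, B.y1, B.z0, B.z1⟩)
        else if wz ≤ wy then
          let c := (B.y0 + B.y1) / 2
          KdTree3.splitY c (kdRefine3T S E P tol d ⟨B.x0, B.x1, B.y0, c, B.z0, B.z1⟩)
            (kdRefine3T S E P tol d ⟨B.x0, B.x1, c, B.y1, B.z0, B.z1⟩)
        else
          let c := (B.z0 + B.z1) / 2
          KdTree3.splitZ c (kdRefine3T S E P tol d ⟨B.x0, B.x1, B.y0, B.y1, B.z0, c⟩)
            (kdRefine3T S E P tol d ⟨B.x0, B.x1, B.y0, B.y1, c, B.z1⟩)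

/-! ### Part D. Graph-shaped limits by two nested substitutions (box-split and adaptive) -/

namespace BExpr3T

/-- Substitute the expression `W` for the second variable. [cite: MakinoBerz2003, Algorithm 2] -/
def substY (W : BExpr3T) : BExpr3T → BExpr3T
  | const q => const q
  | varX => varX
  | varY => W
  | varZ => varZ
  | neg A => neg (substY W A)
  | add A B => add (substY W A) (substY W B)
  | sub A B => sub (substY W A) (substY W B)
  | mul A B => mul (substY W A) (substY W B)
  | exp A => exp (substY W A)
  | log A => log (substY W A)
  | inv A => inv (substY W A)
  | sqrt A => sqrt (substY W A)
  | sin A => sin (substY W A)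
  | cos A => cos (substY W A)

/-- [cite: MakinoBerz2003, Algorithm 2] -/
theorem toFun₃_substY (W : BExpr3T) (x y z : ℝ) :
    ∀ E : BExpr3T, (substY W E).toFun₃ x y z = E.toFun₃ x (W.toFun₃ x y z) z
  | const _ => rfl
  | varX => rfl
  | varY => rfl
  | varZ => rfl
  | neg A => by simp only [substY, toFun₃, toFun₃_substY W x y z A]
  | add A B => by simp only [substY, toFun₃, toFun₃_substY W x y z A, toFun₃_substY W x y z B]
  | sub A B => by simp only [substY, toFun₃, toFun₃_substY W x y z A, toFun₃_substY W x y z B]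
  | mul A B => by simp only [substY, toFun₃, toFun₃_substY W x y z A, toFun₃_substY W x y z B]
  | exp A => by simp only [substY, toFun₃, toFun₃_substY W x y z A]
  | log A => by simp only [substY, toFun₃, toFun₃_substY W x y z A]
  | inv A => by simp only [substY, toFun₃, toFun₃_substY W x y z A]
  | sqrt A => by simp only [substY, toFun₃, toFun₃_substY W x y z A]
  | sin A => by simp only [substY, toFun₃, toFun₃_substY W x y z A]
  | cos A => by simp only [substY, toFun₃, toFun₃_substY W x y z A]

/-- Substitute the expression `W` for the third variable. [cite: MakinoBerz2003, Algorithm 2] -/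
def substZ (W : BExpr3T) : BExpr3T → BExpr3T
  | const q => const q
  | varX => varX
  | varY => varY
  | varZ => W
  | neg A => neg (substZ W A)
  | add A B => add (substZ W A) (substZ W B)
  | sub A B => sub (substZ W A) (substZ W B)
  | mul A B => mul (substZ W A) (substZ W B)
  | exp A => exp (substZ W A)
  | log A => log (substZ W A)
  | inv A => inv (substZ W A)
  | sqrt A => sqrt (substZ W A)
  | sin A => sin (substZ W A)
  | cos A => cos (substZ W A)

/-- [cite: MakinoBerz2003, Algorithm 2] -/
theorem toFun₃_substZ (W : BExpr3T) (x y z : ℝ) :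
    ∀ E : BExpr3T, (substZ W E).toFun₃ x y z = E.toFun₃ x y (W.toFun₃ x y z)
  | const _ => rfl
  | varX => rfl
  | varY => rfl
  | varZ => rfl
  | neg A => by simp only [substZ, toFun₃, toFun₃_substZ W x y z A]
  | add A B => by simp only [substZ, toFun₃, toFun₃_substZ W x y z A, toFun₃_substZ W x y z B]
  | sub A B => by simp only [substZ, toFun₃, toFun₃_substZ W x y z A, toFun₃_substZ W x y z B]
  | mul A B => by simp only [substZ, toFun₃, toFun₃_substZ W x y z A, toFun₃_substZ W x y z B]
  | exp A => by simp only [substZ, toFun₃, toFun₃_substZ W x y z A]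
  | log A => by simp only [substZ, toFun₃, toFun₃_substZ W x y z A]
  | inv A => by simp only [substZ, toFun₃, toFun₃_substZ W x y z A]
  | sqrt A => by simp only [substZ, toFun₃, toFun₃_substZ W x y z A]
  | sin A => by simp only [substZ, toFun₃, toFun₃_substZ W x y z A]
  | cos A => by simp only [substZ, toFun₃, toFun₃_substZ W x y z A]

/-- The expression mentions the first variable only (no `y`, no `z`). [cite: MakinoBerz2003, Algorithm 2] -/
def xOnly : BExpr3T → Bool
  | const _ => true
  | varX => true
  | varY => false
  | varZ => false
  | neg A => xOnly A
  | add A B => xOnly A && xOnly B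
  | sub A B => xOnly A && xOnly B
  | mul A B => xOnly A && xOnly B
  | exp A => xOnly A
  | log A => xOnly A
  | inv A => xOnly A
  | sqrt A => xOnly A
  | sin A => xOnly A
  | cos A => xOnly A

/-- An `xOnly` expression denotes a function of `x` alone. [cite: MakinoBerz2003, Algorithm 2] -/
theorem toFun₃_eq_of_xOnly (x y z y' z' : ℝ) : ∀ A : BExpr3T, A.xOnly = true → A.toFun₃ x y z = A.toFun₃ x y' z'
  | const _, _ => rfl
  | varX, _ => rfl
  | varY, h => by simp [xOnly] at h
  | varZ, h => by simp [xOnly] at h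
  | neg A, h => by
      simp only [xOnly] at h
      simp only [toFun₃, toFun₃_eq_of_xOnly x y z y' z' A h]
  | add A B, h => by
      simp only [xOnly, Bool.and_eq_true] at h
      simp only [toFun₃, toFun₃_eq_of_xOnly x y z y' z' A h.1, toFun₃_eq_of_xOnly x y z y' z' B h.2]
  | sub A B, h => by
      simp only [xOnly, Bool.and_eq_true] at h
      simp only [toFun₃, toFun₃_eq_of_xOnly x y z y' z' A h.1, toFun₃_eq_of_xOnly x y z y' z' B h.2]
  | mul A B, h => by
      simp only [xOnly, Bool.and_eq_true] at h
      simp only [toFun₃, toFun₃_eq_of_xOnly x y z y' z' A h.1, toFun₃_eq_of_xOnly x y z y' z' B h.2]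
  | exp A, h => by
      simp only [xOnly] at h
      simp only [toFun₃, toFun₃_eq_of_xOnly x y z y' z' A h]
  | log A, h => by
      simp only [xOnly] at h
      simp only [toFun₃, toFun₃_eq_of_xOnly x y z y' z' A h]
  | inv A, h => by
      simp only [xOnly] at h
      simp only [toFun₃, toFun₃_eq_of_xOnly x y z y' z' A h]
  | sqrt A, h => by
      simp only [xOnly] at h
      simp only [toFun₃, toFun₃_eq_of_xOnly x y z y' z' A h]
  | sin A, h => by
      simp only [xOnly] at h
      simp only [toFun₃, toFun₃_eq_of_xOnly x y z y' z' A h]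
  | cos A, h => by
      simp only [xOnly] at h
      simp only [toFun₃, toFun₃_eq_of_xOnly x y z y' z' A h]

/-- The expression does not mention the third variable. [cite: MakinoBerz2003, Algorithm 2] -/
def zFree : BExpr3T → Bool
  | const _ => true
  | varX => true
  | varY => true
  | varZ => false
  | neg A => zFree A
  | add A B => zFree A && zFree B
  | sub A B => zFree A && zFree B
  | mul A B => zFree A && zFree B
  | exp A => zFree A
  | log A => zFree A
  | inv A => zFree A
  | sqrt A => zFree A
  | sin A => zFree A
  | cos A => zFree A

/-- A `zFree` expression denotes a function of `(x, y)` alone. [cite: MakinoBerz2003, Algorithm 2] -/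
theorem toFun₃_eq_of_zFree (x y z z' : ℝ) : ∀ A : BExpr3T, A.zFree = true → A.toFun₃ x y z = A.toFun₃ x y z'
  | const _, _ => rfl
  | varX, _ => rfl
  | varY, _ => rfl
  | varZ, h => by simp [zFree] at h
  | neg A, h => by
      simp only [zFree] at h
      simp only [toFun₃, toFun₃_eq_of_zFree x y z z' A h]
  | add A B, h => by
      simp only [zFree, Bool.and_eq_true] at h
      simp only [toFun₃, toFun₃_eq_of_zFree x y z z' A h.1, toFun₃_eq_of_zFree x y z z' B h.2]
  | sub A B, h => by
      simp only [zFree, Bool.and_eq_true] at h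
      simp only [toFun₃, toFun₃_eq_of_zFree x y z z' A h.1, toFun₃_eq_of_zFree x y z z' B h.2]
  | mul A B, h => by
      simp only [zFree, Bool.and_eq_true] at h
      simp only [toFun₃, toFun₃_eq_of_zFree x y z z' A h.1, toFun₃_eq_of_zFree x y z z' B h.2]
  | exp A, h => by
      simp only [zFree] at h
      simp only [toFun₃, toFun₃_eq_of_zFree x y z z' A h]
  | log A, h => by
      simp only [zFree] at h
      simp only [toFun₃, toFun₃_eq_of_zFree x y z z' A h]
  | inv A, h => by
      simp only [zFree] at h
      simp only [toFun₃, toFun₃_eq_of_zFree x y z z' A h]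
  | sqrt A, h => by
      simp only [zFree] at h
      simp only [toFun₃, toFun₃_eq_of_zFree x y z z' A h]
  | sin A, h => by
      simp only [zFree] at h
      simp only [toFun₃, toFun₃_eq_of_zFree x y z z' A h]
  | cos A, h => by
      simp only [zFree] at h
      simp only [toFun₃, toFun₃_eq_of_zFree x y z z' A h]

/-- The inner pull-back `E(x, y, C + t·(D − C)) · (D − C)` on the unit `t`-interval (`t` = the third variable).
[cite: MakinoBerz2003, Algorithm 2] -/
def inner3 (E C D : BExpr3T) : BExpr3T :=
  mul (substZ (add C (mul varZ (sub D C))) E) (sub D C)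

/-- The doubly pulled-back integrand on the unit square in `(s, t)`: `inner3 E C D` at `y = A + s·(B − A)`, times
`(B − A)` (`s` = the second variable, `t` = the third). [cite: MakinoBerz2003, Algorithm 2] -/
def graphIntegrand3 (E A B C D : BExpr3T) : BExpr3T :=
  mul (substY (add A (mul varY (sub B A))) (inner3 E C D)) (sub B A)

end BExpr3T

/-- The affine substitution onto the unit interval (every sign of `b − a`; interval integrals are oriented). [folklore] -/
private theorem integral_unit_subst (f : ℝ → ℝ) (a b : ℝ) :
    ∫ s in (0 : ℝ)..1, (b - a) * f ((b - a) * s + a) = ∫ y in a..b, f y := by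
  rw [intervalIntegral.integral_const_mul, ← smul_eq_mul, intervalIntegral.smul_integral_comp_mul_add]
  simp

/-- **The substitutions `z = C(x,y) + t (D(x,y) − C(x,y))`, then `y = A(x) + s (B(x) − A(x))`, `s, t ∈ [0, 1]`**:
`∫_{x} ∫_{s=0}^{1} ∫_{t=0}^{1} graphIntegrand3 = ∫_{x} ∫_{y=A(x)}^{B(x)} ∫_{z=C(x,y)}^{D(x,y)} E` — the iterated
integral with variable limits, Davis–Rabinowitz (5.6.1.1) for `d = 3`, transformed onto `[x] × [0, 1]²`.
[cite: DavisRabinowitz1984, Sect. 5.6.1] -/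
theorem integral_graphIntegrand3_eq {E A B C D : BExpr3T} (hA : A.xOnly = true) (hB : B.xOnly = true)
    (hC : C.zFree = true) (hD : D.zFree = true) (ax bx : ℝ) :
    ∫ x in ax..bx, ∫ s in (0 : ℝ)..1, ∫ t in (0 : ℝ)..1, (BExpr3T.graphIntegrand3 E A B C D).toFun₃ x s t =
      ∫ x in ax..bx, ∫ y in (A.toFun₃ x 0 0)..(B.toFun₃ x 0 0),
        ∫ z in (C.toFun₃ x y 0)..(D.toFun₃ x y 0), E.toFun₃ x y z := by
  refine intervalIntegral.integral_congr fun x _ => ?_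
  have hin : ∀ y : ℝ, ∫ t in (0 : ℝ)..1, (BExpr3T.inner3 E C D).toFun₃ x y t =
      ∫ z in (C.toFun₃ x y 0)..(D.toFun₃ x y 0), E.toFun₃ x y z := by
    intro y
    have hpt : ∀ t : ℝ, (BExpr3T.inner3 E C D).toFun₃ x y t = (D.toFun₃ x y 0 - C.toFun₃ x y 0) *
        E.toFun₃ x y ((D.toFun₃ x y 0 - C.toFun₃ x y 0) * t + C.toFun₃ x y 0) := by
      intro t
      simp only [BExpr3T.inner3, BExpr3T.toFun₃, BExpr3T.toFun₃_substZ,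
        BExpr3T.toFun₃_eq_of_zFree x y t 0 C hC, BExpr3T.toFun₃_eq_of_zFree x y t 0 D hD]
      ring_nf
    simp_rw [hpt]
    exact integral_unit_subst (fun z => E.toFun₃ x y z) _ _
  have hpt : ∀ s t : ℝ, (BExpr3T.graphIntegrand3 E A B C D).toFun₃ x s t = (B.toFun₃ x 0 0 - A.toFun₃ x 0 0) *
      (BExpr3T.inner3 E C D).toFun₃ x ((B.toFun₃ x 0 0 - A.toFun₃ x 0 0) * s + A.toFun₃ x 0 0) t := by
    intro s t
    simp only [BExpr3T.graphIntegrand3, BExpr3T.toFun₃, BExpr3T.toFun₃_substY,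
      BExpr3T.toFun₃_eq_of_xOnly x s t 0 0 A hA, BExpr3T.toFun₃_eq_of_xOnly x s t 0 0 B hB]
    ring_nf
  show ∫ s in (0 : ℝ)..1, ∫ t in (0 : ℝ)..1, (BExpr3T.graphIntegrand3 E A B C D).toFun₃ x s t = _
  simp_rw [hpt, intervalIntegral.integral_const_mul]
  rw [← intervalIntegral.integral_const_mul,
    integral_unit_subst (fun y => ∫ t in (0 : ℝ)..1, (BExpr3T.inner3 E C D).toFun₃ x y t)]
  exact intervalIntegral.integral_congr fun y _ => hin y

/-- [folklore] -/
private theorem unit_panels_tr3 {m : ℕ} (hm : 0 < m) :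
    ((0 : ℚ) : ℝ) + 2 * (m : ℝ) * (((1 / (2 * (m : ℚ))) : ℚ) : ℝ) = 1 := by
  have hmr : (0 : ℝ) < m := by exact_mod_cast hm
  have hm0 : (m : ℝ) ≠ 0 := hmr.ne'
  push_cast
  field_simp
  ring

/-- **Soundness of the box-split graph certificate**
`lo ≤ ∫_{ax}^{ax+2nh} ∫_{A(x)}^{B(x)} ∫_{C(x,y)}^{D(x,y)} E dz dy dx ≤ hi`: `A`, `B` mention `x` only, `C`, `D` are free
of `z`, `0 < m`, `0 < o`, every box of the pulled-back integrand on `[ax, ax + 2nh] × [0, 1]²` (`s`-panels of half-width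
`1/(2m)`, `t`-panels of half-width `1/(2o)`) passes `boxCheck3T` against its claim, and `sumCheck3T` holds.
[cite: MakinoBerz2003, Algorithm 2] [cite: MahboubiMelquiondSibutpinote2016, Sect. 3.3] -/
theorem integral_bounds_of_boxCheck3GraphT {S : ℕ} {h : ℚ} {P : EPrm} {E A B C D : BExpr3T} {ax : ℚ}
    {Jsss : List (List (List MI))} {n m o : ℕ} {lo hi : ℚ} (hA : A.xOnly = true) (hB : B.xOnly = true)
    (hC : C.zFree = true) (hD : D.zFree = true) (hm : 0 < m) (ho : 0 < o)
    (hbox : ∀ i j p : ℕ, i < n → j < m → p < o → boxCheck3T S h (1 / (2 * (m : ℚ))) (1 / (2 * (o : ℚ))) P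
      (BExpr3T.graphIntegrand3 E A B C D) ax 0 0 Jsss i j p = true)
    (hsum : sumCheck3T S h (1 / (2 * (m : ℚ))) (1 / (2 * (o : ℚ))) P (BExpr3T.graphIntegrand3 E A B C D) ax 0 0
      Jsss n m o lo hi = true) :
    (lo : ℝ) ≤ ∫ x in (ax : ℝ)..((ax : ℝ) + 2 * n * h), ∫ y in (A.toFun₃ x 0 0)..(B.toFun₃ x 0 0),
        ∫ z in (C.toFun₃ x y 0)..(D.toFun₃ x y 0), E.toFun₃ x y z ∧
      ∫ x in (ax : ℝ)..((ax : ℝ) + 2 * n * h), ∫ y in (A.toFun₃ x 0 0)..(B.toFun₃ x 0 0),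
        ∫ z in (C.toFun₃ x y 0)..(D.toFun₃ x y 0), E.toFun₃ x y z ≤ (hi : ℝ) := by
  have hb := integral_bounds_of_boxCheck3T hbox hsum
  rw [unit_panels_tr3 hm, unit_panels_tr3 ho, Rat.cast_zero, integral_graphIntegrand3_eq hA hB hC hD] at hb
  exact hb

/-- **Soundness of the ADAPTIVE graph certificate** `lo ≤ ∫_{x0}^{x1} ∫_{A(x)}^{B(x)} ∫_{C(x,y)}^{D(x,y)} E dz dy dx ≤ hi`:
`A`, `B` mention `x` only, `C`, `D` are free of `z`, and a kd-tree over `[x0, x1] × [0, 1]²` certifies the pulled-back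
integrand leaf by leaf (a vertex of a simplex is thereby refined where the integrand demands it).
[cite: MakinoBerz2003, Algorithm 2] [cite: MahboubiMelquiondSibutpinote2016, Sect. 3.3] -/
theorem integral_bounds_of_leafCheck3GraphT {S : ℕ} {E A B C D : BExpr3T} {t : KdTree3} {x0 x1 : ℚ} {n : ℕ}
    {lo hi : ℚ} (hA : A.xOnly = true) (hB : B.xOnly = true) (hC : C.zFree = true) (hD : D.zFree = true)
    (hleaf : ∀ i : ℕ, i < n → leafCheck3T S (BExpr3T.graphIntegrand3 E A B C D) t ⟨x0, x1, 0, 1, 0, 1⟩ i = true)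
    (ht : treeCheck3T S t n lo hi = true) :
    (lo : ℝ) ≤ ∫ x in (x0 : ℝ)..x1, ∫ y in (A.toFun₃ x 0 0)..(B.toFun₃ x 0 0),
        ∫ z in (C.toFun₃ x y 0)..(D.toFun₃ x y 0), E.toFun₃ x y z ∧
      ∫ x in (x0 : ℝ)..x1, ∫ y in (A.toFun₃ x 0 0)..(B.toFun₃ x 0 0),
        ∫ z in (C.toFun₃ x y 0)..(D.toFun₃ x y 0), E.toFun₃ x y z ≤ (hi : ℝ) := by
  have hb := integral_bounds_of_leafCheck3T hleaf ht
  dsimp only at hb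
  rw [Rat.cast_zero, Rat.cast_one, integral_graphIntegrand3_eq hA hB hC hD] at hb
  exact hb

end PolyMP

end Literature.Analysis.ValidatedNumerics
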